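import Literature.Computability.Complexity.RandomCNF
import Literature.Computability.MetaComplexity.Resolution
import Mathlib.Topology.Instances.ENNReal.Lemmas
import HarnessLib

/-!
# Named fact: random `k`-CNF at constant density needs exponential-size resolution refutations
(Chvátal–Szemerédi 1988)

Trunk T-CPLX-META (Literature/Computability/MetaComplexity); cite item `wi-03697` (route
PneNP/Feige, crux #2: the resolution rung of Feige's hypothesis is a THEOREM).

**Chvátal–Szemerédi 1988, Theorem (abstract / §1).** For every `k ≥ 3` and `c` with
`c · 2^{-k} ≥ 0.7` there is `ε > 0` such that, with probability tending to `1` as `n → ∞`, a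
random family of `cn` clauses of size `k` over `n` variables (each clause drawn independently and
uniformly from the `2^k C(n,k)` clauses on `k` distinct variables — the tree's `randomKCNF k n (cn)`,
`RandomCNF.lean`) is UNSATISFIABLE, yet every resolution refutation of it generates at least
`(1 + ε)^n` clauses. (Ben-Sasson–Wigderson 2001, §6 re-derive this via width: refutation width
`Ω(n)` w.h.p. and the size–width relation, Cor. 3.6 there.)

Rendered with the tree's resolution calculus (`Literature.CplxMeta.IsResRefutation φ π`, `π` a list of
lines, `Resolution.lean`): the event is
`{φ | ¬ φ.Satisfiable ∧ ∀ π, IsResRefutation φ π → (1+ε)^n ≤ |π|}` and its `randomKCNF k n (c n)`-mass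
tends to `1` in `ℝ≥0∞`. The density `c` is a natural number here (`m = c·n` exactly), which is
within the source's statement. Nothing is asserted; users take `(h : chvatal_szemeredi)`.

## References

* V. Chvátal, E. Szemerédi, *Many hard examples for resolution*, J. ACM 35 (1988) 759–768,
  Theorem (stated in the abstract and §1).
* E. Ben-Sasson, A. Wigderson, *Short proofs are narrow — resolution made simple*, J. ACM 48
  (2001) 149–169, §6 (random `k`-CNF), Cor. 3.6 (size–width).
-/

noncomputable section

open Filter Topology Literature.Computability.Complexity

namespace Literature.Computability.MetaComplexity

/-- The Chvátal–Szemerédi event at size parameter `n` and rate `ε`: the formula is unsatisfiable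
and every resolution refutation has at least `(1+ε)^n` lines. [Chvátal–Szemerédi 1988, Theorem] [cite: ChvatalSzemeredi1988, Theorem (§1)] -/
def hardForResolution (ε : ℝ) (n : ℕ) : Set (CNF ℕ) :=
  {φ | ¬ φ.Satisfiable ∧ ∀ π : List (ResLine ℕ), IsResRefutation φ π → (1 + ε) ^ n ≤ (π.length : ℝ)}

/-- NAMED FACT (**Chvátal–Szemerédi 1988, Theorem**): for `k ≥ 3` and a natural density `c` with
`0.7 · 2^k ≤ c`, there is `ε > 0` such that
`Pr_{φ ∼ F_k(n, cn)}[φ unsatisfiable ∧ every resolution refutation of φ has ≥ (1+ε)^n lines] → 1`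
as `n → ∞` (`F_k(n,m) = randomKCNF k n m`). Users take `(h : chvatal_szemeredi)`.
[Chvátal–Szemerédi 1988, Theorem (abstract, §1); Ben-Sasson–Wigderson 2001, §6 with Cor. 3.6] [cite: ChvatalSzemeredi1988, Theorem (§1)] -/
def chvatal_szemeredi : Prop :=
  ∀ (k c : ℕ), 3 ≤ k → (0.7 : ℝ) * 2 ^ k ≤ c → ∃ ε : ℝ, 0 < ε ∧
    Tendsto (fun n : ℕ => (randomKCNF k n (c * n)).toOuterMeasure (hardForResolution ε n))
      atTop (𝓝 1)

/-! ### API -/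

/-- The event is monotone in `ε`: a larger growth rate is a smaller event. [folklore] -/
theorem hardForResolution_mono {ε ε' : ℝ} (hε : 0 ≤ 1 + ε) (h : ε ≤ ε') (n : ℕ) :
    hardForResolution ε' n ⊆ hardForResolution ε n := fun _ ⟨hu, hπ⟩ =>
  ⟨hu, fun π hp => (pow_le_pow_left₀ hε (by linarith) n).trans (hπ π hp)⟩

/-- On the event, the tree's minimal refutation size is at least `(1+ε)^n` (or `⊤`).
[Chvátal–Szemerédi 1988, Theorem] [folklore] -/
theorem le_length_of_mem_hardForResolution {ε : ℝ} {n : ℕ} {φ : CNF ℕ}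
    (h : φ ∈ hardForResolution ε n) {π : List (ResLine ℕ)} (hπ : IsResRefutation φ π) :
    (1 + ε) ^ n ≤ (π.length : ℝ) :=
  h.2 π hπ

/-- For `k = 3` the density hypothesis reads `c ≥ 6` (`0.7 · 8 = 5.6`). [Chvátal–Szemerédi 1988,
§1] [folklore] -/
example : (0.7 : ℝ) * 2 ^ 3 ≤ (6 : ℕ) := by norm_num

end Literature.Computability.MetaComplexity
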